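import Summits.QuantumFields.YangMills.Theorems.AlphaInputsT3ACv3Step
import Summits.QuantumFields.Balaban3D.Proofs.FibreZeroSU2
import Summits.QuantumFields.Balaban3D.Proofs.StarCountFree
import Summits.QuantumFields.Balaban3D.Proofs.Decomposition8
import HarnessLib

/-!
# `AlphaInputsT3ACv3StepTrivPins` — THE v3∕v4 RESIDUAL ROW OF RECORD `PinnedStep.Fibre55WinAC` AT THE TRIVIAL NEW HISTORY, EVERY LEVEL `k`,
# `G = SU(2)`, FROM PRINT'S (55) DATA PINS: the `k ≥ 1` twin of the lane's `k = 0` foothold `Balaban3D.Proofs.FibreZeroSU2.fibre_pair_zero_of_pins`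
# (cell ym3-torus ★★OWNER ACK 36 GO; desk pub/ym-inputs INPUT-LIST v7 §3 I-10; seat ym-inputs-p08 g2; helper `--supports stmt-QuantumFields-20520`)

WHY.  The α-package of the T³ cruxes carries, for every step `k < K` and new history `h′`, the residual row `PinnedStep.Fibre55WinAC 𝔎 X 𝔖 win k h′`
(`…AlphaInputsT3ACv3Step`; projected unchanged by v4 `AlphaInputsT3ACv4CoreRows.fibre55Win`) = [Balaban1985UV3] (55) p.269 «(The integral (49)) ≤
χ_{k+1} exp[−(1/g_k²)A^η(U_{k+1}) − E_k + log σ₀|B(Λ_{k+1})*| + d(𝔤) log g_k|B(Λ_{k+1})*| + log Z^{(k)}(B(Λ_{k+1}), U_{k+1})] × ∫dμ_{C^{(k)}}(A) χ exp[⋯]»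
with (58) p.270, read for the lane's AC tower with the PINNED masses; its consumer of record at the trivial new history is
`LogComparisonRepAtHeights.fibre55Triv_of_fibre55WinAC` (`…RepAtHeightsWinRow`).  The lane proved the row at `k = 0` MODULO PRINT'S (22) PINS
(`FibreZeroSU2.fibre_pair_zero_of_pins`, `FibreZeroLane.fibre_pair_zero_piecesW`) over LEVEL-GENERIC machinery (`AxialGaugeShift.rnTransport_ae_eq_integral_fluct`,
`FluctGaussSU2.fluct_integral_eq_gauss`, `StarCountFree.card_free_eq_starCount`); no supplier existed at any `k ≥ 1`.  THIS FILE proves the row at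
`h′ = triv` for EVERY `k` with `k + 1 ≤ m + K`, for the lane's AC tower over any `S`, `𝔎`, `X` (axial averaging at level `k`), `𝔖`, `win`, modulo:
* print's (12)∕(50) pp.258∕268 «we make the translation V_k = V′_k V_k^{(k)}»: a measurable background section `U₁ : V ↦ V^{(k)}` at level `k`, axial on the
  forest, `Ū₁(V) = V`, whose (42)-minimiser IS `U_{k+1}(V)`: `X.Uk k V = ukAll X.Uk k (U₁ V)` (`hbg`, DISPLAYED — the minimiser's covariance,
  [Balaban1985Variational] Thm 1; `rfl` at `k = 0` with `U₁ := X.Uk 0`);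
* the quadratic datum `q_V` of (53)–(54) with `0 < Z(V) = ∫e^{−q_V}` (`hqm`, `hZ`; `Δ_k > 0` = [B9] Thm 3.11); the data rows `hU`∕`hPm`∕`hPb` of
  `PinnedStep.ineq41_pinned_windowed_ae` at `(k, triv)`; ONE displayed invariance `hinv`: the (41)_k integrand at `triv`,
  `U ↦ e^{−(1/g_k²)A^η(U_k(U,triv)) + 𝒫_k(triv,U)}`, is gauge-invariant (`k = 0`: `FibreZeroSU2.act0_gaugeAct`); `χB_k(triv′)` is invariant by `chiB_gaugeAct`;
* the window-support facts of the R-g18-a edition: `χB_k(triv′)(U) ≠ 0 ⇒ wtP_k(triv_k)(U) = 1` (`hwt` — the consumer's own `hsupp`, at print's (40)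
  windows `AlphaInputsT3AC.wtP_admWindowT3_triv_eq_one`) and `χB_k(triv′)(U) ≠ 0 ⇒ Ū ∈ win_k(triv′)` (`hsmall`; p.268, small plaquettes of `U` ⇒ the
  window of `Ū`, displayed);
* the (55) PINS of `piecesAC 𝔎 X 𝔖 k` at `triv′`: `log σ₀ = log σ(0)` (`hσ`), `d(𝔤) = 3` (`hdg`), `log Z^{(k)}(triv′,V) = log Z_q(V)` (`hZU`),
  `log Fl(triv′,V) = log ∫Ψ_{k,V} dμ_V` (`hFl`) with **Ψ_{k,V}(A′) = 𝟙{‖g_kA′‖ < π}·χB_k(triv′)(U(V,A′))·Π_b σ(g_kA′_b)/σ₀·exp[−((1/g_k²)A^η(U_k(U(V,A′),triv))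
  − (1/g_{k+1}²)A^η(U_{k+1}(V,triv′))) + (𝒫_k(triv,U(V,A′)) − 𝒫old(triv′,V)) + q_V(A′)]**, `U(V,A′) := U′(g_kA′)·U₁(V)` — print's fluctuation
  integrand of (55) with (58)'s recentring of the old terms by `Σ_jΣ_{Y_j}𝒫_j(Y_j,U_{k+1})` (the pieces' `Pold`, hence NO `Pold` pin) and `Ṽ` DEFINED as
  the exact remainder (as in `FluctGaussSU2.fluctIntegrand`; `D̃ ≡ 0` for the decimation average).  The pin `|B(Λ_{k+1}(triv′))*| = #Free` is DISCHARGED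
  at every level (`starB_piecesAC_triv`).
THEN `fibre55WinAC_triv_of_pins : PinnedStep.Fibre55WinAC 𝔎 X 𝔖 win k (Hist.triv S.P (k + 1))` — an IDENTITY turned `≤ᵐ`, NO regularity hypothesis
(that belongs to the lower row (57)).  Road: `stepWeight_triv`∕`massRecP_triv`, `transport_triv_ae_eq_fluct` ((48)+(13)), `fluct_integral_triv_eq`
((50)–(55): `∫ρ_k(U′U₁(V)) dU′ = e^{−mainT_{k+1}(V) − E_k + Z_k + R_k + 𝒫old(V)}·σ₀^N g_k^{3N} Z(V) ∫Ψ dμ`), the window read off the support (`axialAvg_fluct_mul`).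

HONEST SCOPE.  [folklore] measure theory over the lane's kernel theorems; nothing of [Balaban1985UV3] asserted; the row is proved MODULO PINS that say
what the B0 definer's `𝔖_Bal` must make of `logFl ∕ logZU ∕ logσ₀ ∕ dg` at the trivial history — NO (O″χ) row is discharged at free data (RULING g26-№2:
the pins move R3D-01(triv)'s content into the rows about those pieces); count-neutral; no summit ∕ sub-problem statement proved (rung R3 bookkeeping;
not T⁴, not Clay; the Yang–Mills mass gap is NOT proved).  Def-free.  References: T. Bałaban, CMP 102 (1985) 255–275 [Balaban1985UV3] ((12)–(13)
pp.258–259, (22) p.261, (40)–(42) p.266, (48)–(51) p.268, (53)–(55) p.269, (58) p.270, p.272 L32–33); CMP 102 (1985) 277–309 [Balaban1985Variational] (Thm 1).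
-/

set_option autoImplicit false

noncomputable section

namespace Summit.QuantumFields.YangMills.Theorems.PinnedStepTrivPins

open MeasureTheory Metric Literature.MathematicalPhysics.QuantumFieldTheory.Balaban1983to89
open Literature.MathematicalPhysics.QuantumFieldTheory.Balaban1983to89.AveragingRT (axialAvg rnTransport)
open Literature.MathematicalPhysics.QuantumFieldTheory.Balaban1983to89.GaugeField (GaugeInvariant gaugeAct)
open Literature.MathematicalPhysics.QuantumFieldTheory.Balaban1983to89.T4HaarSU2ExpChart (expWeight)
open Literature.MathematicalPhysics.QuantumFieldTheory.Balaban1985CMP102 Literature.MathematicalPhysics.QuantumFieldTheory.Balaban1985CMP102.Setting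
open Summit.QuantumFields.Balaban3D.Carriers
open Summit.QuantumFields.Balaban3D.Proofs.Inputs (LaneConsts)
open Summit.QuantumFields.Balaban3D.Proofs.ScalesArithmetic (gk_pos)
open Summit.QuantumFields.Balaban3D.Proofs.TowerAC Summit.QuantumFields.Balaban3D.Proofs.StandardAC Summit.QuantumFields.Balaban3D.Proofs.InputsAC
open Summit.QuantumFields.Balaban3D.Proofs.Bound55Masses (chiB chiB_nonneg chiB_le_one measurable_chiB)
open Summit.QuantumFields.Balaban3D.Proofs.MassesPAC
open Summit.QuantumFields.Balaban3D.Proofs.ProductChartSU2 (SU2)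
open Summit.QuantumFields.Balaban3D.Proofs.AxialGaugeFix (forest axGlue axialAvg_axGlue)
open Summit.QuantumFields.Balaban3D.Proofs.AxialGaugeShift (fluct rnTransport_ae_eq_integral_fluct axGlue_mulRight)
open Summit.QuantumFields.Balaban3D.Proofs.FluctGaussSU2
open Summit.QuantumFields.Balaban3D.Proofs.ChartScalingSU2 (E3)
open Summit.QuantumFields.Balaban3D.Proofs.GaussianNormalization (partZ normalized)
open Summit.QuantumFields.Balaban3D.Proofs.FibreZeroSU2 (act0 inv_gk_sq_mul_actionEta)
open Summit.QuantumFields.Balaban3D.Proofs (Bound55Std.measurable_actionEta Bound55Std.actionEta_nonneg)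
open Summit.QuantumFields.YangMills.Theorems.PinnedStep (massP wtP Fibre55WinAC)

variable {L : ℕ} (𝔎 : LaneConsts L) {S : Scales L}

/-! ## §1 Bookkeeping at the trivial history, any gauge group -/

section General

variable {G : Type} [GaugeGroup G] [MeasurableSpace G] [HaarData G]
  {Val : Type} [NormedAddCommGroup Val] [NormedSpace ℂ Val]
  (X : ExternalInputsAC S G) (𝔖 : ∀ k, StepSeries S G Val (nblkOf S 𝔎.carrier k) k)

omit [MeasurableSpace G] [HaarData G] in
/-- **The small-field factor `χB` of (49) is gauge-invariant** (plaquette holonomies are conjugated, `dist1` is a class function —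
`Decomposition8.dist1_plaqHol_gaugeAct`). [cite: Balaban1985UV3, (7) p.257 + (49) p.268] -/
theorem chiB_gaugeAct (M₁ : ℕ) (Rcol : ℕ → ℕ) (εS : ℕ → ℝ) (k : ℕ) (h' : Hist S.P (k + 1)) (u : GaugeTransf S.P k G)
    (U : GaugeField S.P k G) : chiB M₁ Rcol εS k h' (gaugeAct u U) = chiB M₁ Rcol εS k h' U := by
  unfold chiB; congr 1; simp only [Summit.QuantumFields.Balaban3D.Proofs.Decomposition8.dist1_plaqHol_gaugeAct]

/-- d = 3 scaling of the main term at every level: `(1/g_k²)·A^{η_k}(U_k(U,h)) = (1/g₀²)·A(U_k(U,h))`. [cite: Balaban1985UV3, (36) p.265 + (41) p.266] -/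
theorem mainT_eq_act0 (k : ℕ) (h : Hist S.P k) (U : GaugeField S.P k G) :
    (towerOfAC 𝔎 X 𝔖).mainT k h U = act0 S (X.UkH k h U) := by
  show (S.gk k)⁻¹ ^ 2 * S.actionEta k (X.UkH k h U) = _; exact inv_gk_sq_mul_actionEta k _

/-- **«V_k = V′_k V_k^{(k)}»**: if the (42)-minimiser of `V` is the level-`k` minimiser of `U₁(V)` (`X.Uk k V = ukAll X.Uk k (U₁ V)`), then
`mainT_{k+1}(triv′, V) = mainT_k(triv, U₁ V)`. [cite: Balaban1985UV3, (42) p.266 + (50) p.268] -/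
theorem mainT_triv_succ_eq (k : ℕ) (U₁ : GaugeField S.P (k + 1) G → GaugeField S.P k G)
    (hbg : ∀ V, X.Uk k V = ukAll X.Uk k (U₁ V)) (V : GaugeField S.P (k + 1) G) :
    (towerOfAC 𝔎 X 𝔖).mainT (k + 1) (Hist.triv S.P (k + 1)) V = (towerOfAC 𝔎 X 𝔖).mainT k (Hist.triv S.P k) (U₁ V) := by
  rw [mainT_eq_act0, mainT_eq_act0, X.UkH_triv, X.UkH_triv]; show act0 S (X.Uk k V) = act0 S (ukAll X.Uk k (U₁ V)); rw [hbg]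

/-- The main term is non-negative. [cite: Balaban1985UV3, (41) p.266] -/
theorem mainT_nonneg [RegularGaugeGroup G] (k : ℕ) (h : Hist S.P k) (U : GaugeField S.P k G) :
    0 ≤ (towerOfAC 𝔎 X 𝔖).mainT k h U := by
  show 0 ≤ (S.gk k)⁻¹ ^ 2 * S.actionEta k (X.UkH k h U); exact mul_nonneg (sq_nonneg _) (Bound55Std.actionEta_nonneg (S := S) k _)

/-- **The pin `|B(Λ_{k+1}(triv′))*| = #free bonds` HOLDS for the lane's AC pieces at every level** (`Carriers.lamFin_triv`, `piecesParamsOf_starB`,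
`StarCountFree.card_free_eq_starCount`). [cite: Balaban1985UV3, p.260 (after (18)) + (55) p.269] -/
theorem starB_piecesAC_triv (k : ℕ) [DecidableEq (PBond S.P k)] (hk : k + 1 ≤ S.P.m + S.P.K) :
    (piecesAC 𝔎 X 𝔖 k).starB (Hist.triv S.P (k + 1)) = (Fintype.card (Free S.P k) : ℝ) := by
  show (piecesParamsOf S 𝔎.carrier k).starB (Hist.triv S.P (k + 1)) = _
  rw [piecesParamsOf_starB, lamFin_triv _ _ hk, ← Summit.QuantumFields.Balaban3D.Proofs.StarCountFree.card_free_eq_starCount hk]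
  push_cast; rfl

/-- The pinned mass of the trivial history is `1` at every level (`MassesPAC.massRecP_triv`). [cite: Balaban1985UV3, (47) p.267 + p.272 L32–33] -/
theorem massP_triv (k : ℕ) (V : GaugeField S.P k G) : massP 𝔎 X k (Hist.triv S.P k) V = 1 :=
  massRecP_triv _ _ _ _ _ k V

end General

/-! ## §2 G = SU(2): the transported (41)_k integrand at the trivial history, computed -/

section SU2

variable {Val : Type} [NormedAddCommGroup Val] [NormedSpace ℂ Val]
  (X : ExternalInputsAC S SU2) (𝔖 : ∀ k, StepSeries S SU2 Val (nblkOf S 𝔎.carrier k) k)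
  (win : (k : ℕ) → Hist S.P (k + 1) → Set (GaugeField S.P (k + 1) SU2))

/-- A field of the form `U′·U₁(V)` with `U′` a fluctuation field and `U₁(V)` axial in the fibre of `V` lies in the fibre of `V`:
`(fluct W · U₁ V)‾ = V` (`axGlue_mulRight` + `axialAvg_axGlue`). [cite: Balaban1985UV3, (12)–(13) p.258–259] -/
theorem axialAvg_fluct_mul (k : ℕ) [DecidableEq (PBond S.P k)] (hk : k + 1 ≤ S.P.m + S.P.K)
    (U₁ : GaugeField S.P (k + 1) SU2 → GaugeField S.P k SU2) (hax : ∀ V, ∀ b ∈ forest S.P k, U₁ V b = 1)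
    (hfib : ∀ V, axialAvg (U₁ V) = V) (V : GaugeField S.P (k + 1) SU2) (W : GaugeField S.P k SU2) :
    axialAvg (fun b => fluct W b * U₁ V b) = V := by
  rw [← axGlue_mulRight hk V (U₁ V) (hax V) (hfib V) W]; exact axialAvg_axGlue hk V _

/-- **THE TRANSFORM OF THE (41)_k INTEGRAND AT THE TRIVIAL HISTORY AS A FLUCTUATION INTEGRAL AROUND `U₁(V)`** ((48) + (12)–(13) for the lane's
axial averaging at level `k`): for the gauge-invariant, bounded integrand `ρ_k = χB_k(triv′)·e^{−mainT_k(triv) + 𝒫_k(triv) − E_k + Z_k(triv) + R_k}`,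
`(T_kρ_k)(V) = ∫ ρ_k(fluct W · U₁(V)) dW` for dV-a.e. `V`. [cite: Balaban1985UV3, (13) p.259 + (48)–(50) p.268] -/
theorem transport_triv_ae_eq_fluct (k : ℕ) [DecidableEq (PBond S.P k)] (hk : k + 1 ≤ S.P.m + S.P.K)
    (hav : (X.av k).avg = axialAvg)
    (U₁ : GaugeField S.P (k + 1) SU2 → GaugeField S.P k SU2) (hax : ∀ V, ∀ b ∈ forest S.P k, U₁ V b = 1)
    (hfib : ∀ V, axialAvg (U₁ V) = V)
    (hU : Measurable (X.UkH k (Hist.triv S.P k))) (hPm : Measurable ((inputOfAC 𝔎 X 𝔖).Pint k (Hist.triv S.P k)))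
    (cP : ℝ) (hPb : ∀ U, (inputOfAC 𝔎 X 𝔖).Pint k (Hist.triv S.P k) U ≤ cP)
    (hinv : GaugeInvariant (fun U : GaugeField S.P k SU2 =>
      Real.exp (-((towerOfAC 𝔎 X 𝔖).mainT k (Hist.triv S.P k) U) + (towerOfAC 𝔎 X 𝔖).Pint k (Hist.triv S.P k) U))) :
    rnTransport (X.av k).avg (fun U =>
        chiB 𝔎.carrier.M₁ (rcolOf S 𝔎.carrier) (eps1Of S 𝔎.carrier) k (Hist.triv S.P (k + 1)) U *
          Real.exp (-((towerOfAC 𝔎 X 𝔖).mainT k (Hist.triv S.P k) U) + (towerOfAC 𝔎 X 𝔖).Pint k (Hist.triv S.P k) U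
            - (towerOfAC 𝔎 X 𝔖).Ecst k + (towerOfAC 𝔎 X 𝔖).Zterm k (Hist.triv S.P k) + (towerOfAC 𝔎 X 𝔖).Rm k))
      =ᵐ[fieldMeasure S.P (k + 1) SU2] fun V =>
        ∫ W, chiB 𝔎.carrier.M₁ (rcolOf S 𝔎.carrier) (eps1Of S 𝔎.carrier) k (Hist.triv S.P (k + 1)) (fun b => fluct W b * U₁ V b) *
          Real.exp (-((towerOfAC 𝔎 X 𝔖).mainT k (Hist.triv S.P k) (fun b => fluct W b * U₁ V b))
            + (towerOfAC 𝔎 X 𝔖).Pint k (Hist.triv S.P k) (fun b => fluct W b * U₁ V b)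
            - (towerOfAC 𝔎 X 𝔖).Ecst k + (towerOfAC 𝔎 X 𝔖).Zterm k (Hist.triv S.P k) + (towerOfAC 𝔎 X 𝔖).Rm k)
          ∂(fieldMeasure S.P k SU2) := by
  set E₀ : ℝ := -(towerOfAC 𝔎 X 𝔖).Ecst k + (towerOfAC 𝔎 X 𝔖).Zterm k (Hist.triv S.P k) + (towerOfAC 𝔎 X 𝔖).Rm k with hE₀
  set χ₀ : GaugeField S.P k SU2 → ℝ :=
    chiB 𝔎.carrier.M₁ (rcolOf S 𝔎.carrier) (eps1Of S 𝔎.carrier) k (Hist.triv S.P (k + 1)) with hχ₀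
  set ρ : Density S.P k SU2 := fun U => χ₀ U *
    Real.exp (-((towerOfAC 𝔎 X 𝔖).mainT k (Hist.triv S.P k) U) + (towerOfAC 𝔎 X 𝔖).Pint k (Hist.triv S.P k) U
      - (towerOfAC 𝔎 X 𝔖).Ecst k + (towerOfAC 𝔎 X 𝔖).Zterm k (Hist.triv S.P k) + (towerOfAC 𝔎 X 𝔖).Rm k) with hρ
  have hmain : ∀ U, (towerOfAC 𝔎 X 𝔖).mainT k (Hist.triv S.P k) U = (S.gk k)⁻¹ ^ 2 * S.actionEta k (X.UkH k (Hist.triv S.P k) U) := fun _ => rfl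
  have hPt : ∀ U, (towerOfAC 𝔎 X 𝔖).Pint k (Hist.triv S.P k) U = (inputOfAC 𝔎 X 𝔖).Pint k (Hist.triv S.P k) U := fun _ => rfl
  have hχm : Measurable χ₀ := measurable_chiB _ _ _ k _
  have hexpm : Measurable fun U : GaugeField S.P k SU2 =>
      -((towerOfAC 𝔎 X 𝔖).mainT k (Hist.triv S.P k) U) + (towerOfAC 𝔎 X 𝔖).Pint k (Hist.triv S.P k) U
        - (towerOfAC 𝔎 X 𝔖).Ecst k + (towerOfAC 𝔎 X 𝔖).Zterm k (Hist.triv S.P k) + (towerOfAC 𝔎 X 𝔖).Rm k := by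
    simp_rw [hmain, hPt]
    exact ((((measurable_const.mul ((Bound55Std.measurable_actionEta (S := S) k).comp hU)).neg.add hPm).sub
      measurable_const).add measurable_const).add measurable_const
  have hρm : Measurable ρ := hχm.mul (Real.measurable_exp.comp hexpm)
  have hρb : ∀ U, |ρ U| ≤ Real.exp (cP + E₀) := fun U => by
    have h0 := mainT_nonneg 𝔎 X 𝔖 k (Hist.triv S.P k) U; have h1 := hPb U
    have hle : -((towerOfAC 𝔎 X 𝔖).mainT k (Hist.triv S.P k) U) + (towerOfAC 𝔎 X 𝔖).Pint k (Hist.triv S.P k) U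
        - (towerOfAC 𝔎 X 𝔖).Ecst k + (towerOfAC 𝔎 X 𝔖).Zterm k (Hist.triv S.P k) + (towerOfAC 𝔎 X 𝔖).Rm k ≤ cP + E₀ := by
      rw [hE₀, hPt]; linarith
    rw [hρ]; dsimp only; rw [abs_mul, Real.abs_exp, abs_of_nonneg (chiB_nonneg _ _ _ k _ U)]
    calc χ₀ U * Real.exp _ ≤ 1 * Real.exp (cP + E₀) :=
          mul_le_mul (chiB_le_one _ _ _ k _ U) (Real.exp_le_exp.mpr hle) (Real.exp_pos _).le zero_le_one
      _ = Real.exp (cP + E₀) := one_mul _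
  have hρi : Integrable ρ (fieldMeasure S.P k SU2) := AveragingRT.integrable_of_abs_le hρm _ hρb
  have hρinv : GaugeInvariant ρ := fun u U => by
    have h1 : χ₀ (gaugeAct u U) = χ₀ U := chiB_gaugeAct _ _ _ k _ u U
    have h2 := hinv u U; dsimp only at h2
    have e : ∀ W : GaugeField S.P k SU2, ρ W = χ₀ W * (Real.exp (-((towerOfAC 𝔎 X 𝔖).mainT k (Hist.triv S.P k) W)
        + (towerOfAC 𝔎 X 𝔖).Pint k (Hist.triv S.P k) W) * Real.exp E₀) := fun W => by
      rw [hρ]; dsimp only; rw [← Real.exp_add]; congr 2; rw [hE₀]; ring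
    rw [e, e, h1, h2]
  rw [hav]; exact rnTransport_ae_eq_integral_fluct hk ρ hρi hρm hρinv U₁ hax hfib

/-- **THE GAUGE-FIXED FLUCTUATION INTEGRAL AT LEVEL `k`, COMPUTED** ((50)–(55) for the lane's axial averaging, `G = SU(2)`, at the trivial history):
`∫ ρ_k(fluct W · U₁(V)) dW = e^{−mainT_{k+1}(triv′,V) − E_k + Z_k(triv) + R_k + 𝒫old(triv′,V)} · σ₀^N · g_k^{3N} · Z_q(V) · ∫ Ψ_{k,V} dμ_V` with `N` = #free
bonds at level `k`, `dμ_V = Z_q(V)⁻¹e^{−q_V}dA′` and `Ψ_{k,V}` print's fluctuation integrand of (55) with (58)'s recentring of the old terms (module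
docstring).  Pointwise in `V`; the d = 3 scaling and `hbg` turn the chart's recentring `mainT_k(triv, U₁ V)` into `mainT_{k+1}(triv′, V)`.
[cite: Balaban1985UV3, (50)–(55) pp.268–269 + (58) p.270] -/
theorem fluct_integral_triv_eq (k : ℕ) [DecidableEq (PBond S.P k)] (hk : k + 1 ≤ S.P.m + S.P.K)
    (U₁ : GaugeField S.P (k + 1) SU2 → GaugeField S.P k SU2) (hbg : ∀ V, X.Uk k V = ukAll X.Uk k (U₁ V))
    (q : GaugeField S.P (k + 1) SU2 → (Free S.P k → E3) → ℝ)
    (hU : Measurable (X.UkH k (Hist.triv S.P k))) (hPm : Measurable ((inputOfAC 𝔎 X 𝔖).Pint k (Hist.triv S.P k)))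
    (cP : ℝ) (hPb : ∀ U, (inputOfAC 𝔎 X 𝔖).Pint k (Hist.triv S.P k) U ≤ cP)
    (V : GaugeField S.P (k + 1) SU2) (hqm : Measurable (q V)) (hZ : 0 < partZ (volume : Measure (Free S.P k → E3)) (q V)) :
    ∫ W, chiB 𝔎.carrier.M₁ (rcolOf S 𝔎.carrier) (eps1Of S 𝔎.carrier) k (Hist.triv S.P (k + 1)) (fun b => fluct W b * U₁ V b) *
          Real.exp (-((towerOfAC 𝔎 X 𝔖).mainT k (Hist.triv S.P k) (fun b => fluct W b * U₁ V b))
            + (towerOfAC 𝔎 X 𝔖).Pint k (Hist.triv S.P k) (fun b => fluct W b * U₁ V b)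
            - (towerOfAC 𝔎 X 𝔖).Ecst k + (towerOfAC 𝔎 X 𝔖).Zterm k (Hist.triv S.P k) + (towerOfAC 𝔎 X 𝔖).Rm k)
          ∂(fieldMeasure S.P k SU2)
      = Real.exp (-((towerOfAC 𝔎 X 𝔖).mainT (k + 1) (Hist.triv S.P (k + 1)) V) - (towerOfAC 𝔎 X 𝔖).Ecst k
            + (towerOfAC 𝔎 X 𝔖).Zterm k (Hist.triv S.P k) + (towerOfAC 𝔎 X 𝔖).Rm k + (piecesAC 𝔎 X 𝔖 k).Pold (Hist.triv S.P (k + 1)) V) *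
        (sigma0 ^ Fintype.card (Free S.P k) * S.gk k ^ (3 * Fintype.card (Free S.P k)) *
          partZ (volume : Measure (Free S.P k → E3)) (q V) *
          ∫ A, (Set.univ.pi fun _ : Free S.P k => ball (0 : E3) Real.pi).indicator (fun _ => (1 : ℝ)) (S.gk k • A) *
              chiB 𝔎.carrier.M₁ (rcolOf S 𝔎.carrier) (eps1Of S 𝔎.carrier) k (Hist.triv S.P (k + 1)) (fieldAt U₁ (S.gk k) V A) *
              (∏ i, expWeight ((S.gk k • A) i) / sigma0) *
              Real.exp (-((towerOfAC 𝔎 X 𝔖).mainT k (Hist.triv S.P k) (fieldAt U₁ (S.gk k) V A)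
                  - (towerOfAC 𝔎 X 𝔖).mainT (k + 1) (Hist.triv S.P (k + 1)) V)
                + ((towerOfAC 𝔎 X 𝔖).Pint k (Hist.triv S.P k) (fieldAt U₁ (S.gk k) V A) - (piecesAC 𝔎 X 𝔖 k).Pold (Hist.triv S.P (k + 1)) V)
                + q V A)
            ∂(normalized (volume : Measure (Free S.P k → E3)) (q V))) := by
  set mT : GaugeField S.P k SU2 → ℝ := fun U => (towerOfAC 𝔎 X 𝔖).mainT k (Hist.triv S.P k) U with hmT
  set Pt : GaugeField S.P k SU2 → ℝ := fun U => (towerOfAC 𝔎 X 𝔖).Pint k (Hist.triv S.P k) U with hPt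
  set m₁ : ℝ := (towerOfAC 𝔎 X 𝔖).mainT (k + 1) (Hist.triv S.P (k + 1)) V with hm₁
  set Po : ℝ := (piecesAC 𝔎 X 𝔖 k).Pold (Hist.triv S.P (k + 1)) V with hPo
  set E₀ : ℝ := -(towerOfAC 𝔎 X 𝔖).Ecst k + (towerOfAC 𝔎 X 𝔖).Zterm k (Hist.triv S.P k) + (towerOfAC 𝔎 X 𝔖).Rm k with hE₀
  set χ₀ : GaugeField S.P k SU2 → ℝ :=
    chiB 𝔎.carrier.M₁ (rcolOf S 𝔎.carrier) (eps1Of S 𝔎.carrier) k (Hist.triv S.P (k + 1)) with hχ₀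
  set Sk : GaugeField S.P k SU2 → ℝ := fun U => mT U + (cP - Pt U) with hSk
  have hmain : ∀ U, mT U = (S.gk k)⁻¹ ^ 2 * S.actionEta k (X.UkH k (Hist.triv S.P k) U) := fun _ => rfl
  have hSm : Measurable Sk := by
    have hPm' : Measurable Pt := hPm
    simp_rw [hSk, hmain]
    exact (measurable_const.mul ((Bound55Std.measurable_actionEta (S := S) k).comp hU)).add (measurable_const.sub hPm')
  have hPt' : ∀ U, Pt U = (inputOfAC 𝔎 X 𝔖).Pint k (Hist.triv S.P k) U := fun _ => rfl
  have hS0 : ∀ U, 0 ≤ Sk U := fun U => by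
    have h0 : 0 ≤ mT U := mainT_nonneg 𝔎 X 𝔖 k (Hist.triv S.P k) U
    have h1 : Pt U ≤ cP := by rw [hPt']; exact hPb U
    show 0 ≤ mT U + (cP - Pt U); linarith
  have hχm : Measurable χ₀ := measurable_chiB _ _ _ k _
  have hχb : ∀ U, |χ₀ U| ≤ 1 := fun U => by
    rw [abs_of_nonneg (chiB_nonneg _ _ _ k _ U)]; exact chiB_le_one _ _ _ k _ U
  have hg : 0 < S.gk k := gk_pos S k
  have hSU₁ : Sk (U₁ V) = m₁ + (cP - Pt (U₁ V)) := by
    show mT (U₁ V) + (cP - Pt (U₁ V)) = m₁ + (cP - Pt (U₁ V))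
    rw [hmT, hm₁]; simp only
    rw [mainT_triv_succ_eq 𝔎 X 𝔖 k U₁ hbg V]
  have hpt : ∀ U : GaugeField S.P k SU2, χ₀ U * Real.exp (-(mT U) + Pt U - (towerOfAC 𝔎 X 𝔖).Ecst k
        + (towerOfAC 𝔎 X 𝔖).Zterm k (Hist.triv S.P k) + (towerOfAC 𝔎 X 𝔖).Rm k)
      = χ₀ U * Real.exp (-(Sk U)) * Real.exp (cP + E₀) := fun U => by
    rw [mul_assoc, ← Real.exp_add]; congr 2; rw [hSk, hE₀]; simp only; ring
  simp_rw [show ∀ W : GaugeField S.P k SU2, (towerOfAC 𝔎 X 𝔖).mainT k (Hist.triv S.P k) (fun b => fluct W b * U₁ V b)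
      = mT (fun b => fluct W b * U₁ V b) from fun _ => rfl,
    show ∀ W : GaugeField S.P k SU2, (towerOfAC 𝔎 X 𝔖).Pint k (Hist.triv S.P k) (fun b => fluct W b * U₁ V b)
      = Pt (fun b => fluct W b * U₁ V b) from fun _ => rfl,
    show ∀ A, (towerOfAC 𝔎 X 𝔖).mainT k (Hist.triv S.P k) (fieldAt U₁ (S.gk k) V A) = mT (fieldAt U₁ (S.gk k) V A) from fun _ => rfl,
    show ∀ A, (towerOfAC 𝔎 X 𝔖).Pint k (Hist.triv S.P k) (fieldAt U₁ (S.gk k) V A) = Pt (fieldAt U₁ (S.gk k) V A) from fun _ => rfl]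
  simp_rw [hpt]
  rw [integral_mul_const, fluct_integral_eq_gauss hk Sk χ₀ hSm hS0 hχm hχb q U₁ hg V hqm hZ, hSU₁]
  have hΨ : ∀ A : Free S.P k → E3, fluctIntegrand Sk χ₀ q U₁ (S.gk k) V A * Real.exp (Pt (U₁ V) - Po)
      = (Set.univ.pi fun _ : Free S.P k => ball (0 : E3) Real.pi).indicator (fun _ => (1 : ℝ)) (S.gk k • A) *
          χ₀ (fieldAt U₁ (S.gk k) V A) * (∏ i, expWeight ((S.gk k • A) i) / sigma0) *
          Real.exp (-(mT (fieldAt U₁ (S.gk k) V A) - m₁) + (Pt (fieldAt U₁ (S.gk k) V A) - Po) + q V A) := fun A => by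
    unfold fluctIntegrand
    rw [hSU₁, mul_assoc _ (Real.exp _) (Real.exp _), ← Real.exp_add]
    congr 2
    show -(mT (fieldAt U₁ (S.gk k) V A) + (cP - Pt (fieldAt U₁ (S.gk k) V A)) - (m₁ + (cP - Pt (U₁ V)))) + q V A
        + (Pt (U₁ V) - Po) = _
    ring
  have hI : ∫ A, fluctIntegrand Sk χ₀ q U₁ (S.gk k) V A ∂(normalized (volume : Measure (Free S.P k → E3)) (q V))
      = Real.exp (Po - Pt (U₁ V)) *
        ∫ A, (Set.univ.pi fun _ : Free S.P k => ball (0 : E3) Real.pi).indicator (fun _ => (1 : ℝ)) (S.gk k • A) *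
            χ₀ (fieldAt U₁ (S.gk k) V A) * (∏ i, expWeight ((S.gk k • A) i) / sigma0) *
            Real.exp (-(mT (fieldAt U₁ (S.gk k) V A) - m₁) + (Pt (fieldAt U₁ (S.gk k) V A) - Po) + q V A)
          ∂(normalized (volume : Measure (Free S.P k → E3)) (q V)) := by
    rw [← integral_const_mul]
    refine integral_congr_ae (Filter.Eventually.of_forall fun A => ?_)
    dsimp only
    rw [← hΨ A, mul_comm (Real.exp _), mul_assoc, ← Real.exp_add, show Pt (U₁ V) - Po + (Po - Pt (U₁ V)) = 0 by ring,
      Real.exp_zero, mul_one]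
  rw [hI]
  have h3 : Real.exp (-m₁ - (towerOfAC 𝔎 X 𝔖).Ecst k + (towerOfAC 𝔎 X 𝔖).Zterm k (Hist.triv S.P k) + (towerOfAC 𝔎 X 𝔖).Rm k + Po)
      = Real.exp (-(m₁ + (cP - Pt (U₁ V)))) * Real.exp (Po - Pt (U₁ V)) * Real.exp (cP + E₀) := by
    rw [← Real.exp_add, ← Real.exp_add]; congr 1; rw [hE₀]; ring
  rw [h3]; ring

/-- Real arithmetic of the (55) exponent: `e^{E}·(σ^N g^{3N} Z·I) ≤ e^{E + (log σ + 3 log g)N + log Z + log I}` for `σ, g, Z > 0`, `I ≥ 0`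
(equality when `I > 0`; Mathlib's `log 0 = 0` makes the right side `e^{…} ≥ 0` when `I = 0`). [folklore] -/
theorem exp_mul_le_exp_log_pins (E σ g Z I : ℝ) (N : ℕ) (hσ : 0 < σ) (hg : 0 < g) (hZ : 0 < Z) (hI : 0 ≤ I) :
    Real.exp E * (σ ^ N * g ^ (3 * N) * Z * I) ≤ Real.exp (E + ((Real.log σ + 3 * Real.log g) * N + Real.log Z + Real.log I)) := by
  have e1 : Real.exp (Real.log σ * N) = σ ^ N := by rw [mul_comm, Real.exp_nat_mul, Real.exp_log hσ]
  have e2 : Real.exp (3 * Real.log g * N) = g ^ (3 * N) := by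
    rw [show (3 : ℝ) * Real.log g * N = ((3 * N : ℕ) : ℝ) * Real.log g by push_cast; ring, Real.exp_nat_mul, Real.exp_log hg]
  have e3 : Real.exp (Real.log Z) = Z := Real.exp_log hZ
  have key : Real.exp (E + ((Real.log σ + 3 * Real.log g) * N + Real.log Z + Real.log I))
      = Real.exp E * (σ ^ N * g ^ (3 * N) * Z) * Real.exp (Real.log I) := by
    have h : Real.exp E * (σ ^ N * g ^ (3 * N) * Z) * Real.exp (Real.log I)
        = Real.exp E * (Real.exp (Real.log σ * N) * Real.exp (3 * Real.log g * N) * Real.exp (Real.log Z)) * Real.exp (Real.log I) := by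
      rw [e1, e2, e3]
    rw [h, ← Real.exp_add, ← Real.exp_add, ← Real.exp_add, ← Real.exp_add]
    congr 1
    ring
  rw [key, show Real.exp E * (σ ^ N * g ^ (3 * N) * Z * I) = Real.exp E * (σ ^ N * g ^ (3 * N) * Z) * I by ring]
  refine mul_le_mul_of_nonneg_left ?_ (by positivity)
  rcases hI.eq_or_lt with h0 | hpos
  · rw [← h0]; exact (Real.exp_pos _).le
  · rw [Real.exp_log hpos]

/-! ## §3 The row at the trivial new history, from the pins -/

/-- **R3D-01 AT THE TRIVIAL NEW HISTORY, EVERY LEVEL, MODULO PRINT'S (55) DATA PINS** — the `k ≥ 1` twin of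
`FibreZeroSU2.fibre_pair_zero_of_pins` (upper half): for `G = SU(2)`, the lane's axial averaging at level `k` (standing range), a measurable
background section `U₁` — axial on the forest, `Ū₁(V) = V`, whose (42)-minimiser is `U_{k+1}(V)` —, a measurable quadratic datum `q_V` with
`Z_q(V) > 0`, the data rows at `(k, triv)`, the displayed gauge invariance of the (41)_k integrand at `triv`, the two window-support facts of the
R-g18-a edition, and the pins `log σ₀ = log σ(0)`, `d(𝔤) = 3`, `log Z^{(k)}(triv′, ·) = log Z_q`, `log Fl(triv′, V) = log ∫Ψ_{k,V} dμ_V`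
(print's (55) fluctuation integrand, module docstring; the pin `|B(Λ_{k+1})*| = #Free` is discharged): the v3∕v4 residual row
`PinnedStep.Fibre55WinAC 𝔎 X 𝔖 win k triv′` HOLDS.  Equality on `{∫Ψ > 0}`, `0 ≤ …` elsewhere; off the window both sides vanish.  No regularity
hypothesis. [cite: Balaban1985UV3, (49)–(55) pp.268–269 + (58) p.270 + p.272 L32–33] -/
theorem fibre55WinAC_triv_of_pins (k : ℕ) [DecidableEq (PBond S.P k)] (hk : k + 1 ≤ S.P.m + S.P.K)
    (hav : (X.av k).avg = axialAvg)
    (U₁ : GaugeField S.P (k + 1) SU2 → GaugeField S.P k SU2) (hax : ∀ V, ∀ b ∈ forest S.P k, U₁ V b = 1)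
    (hfib : ∀ V, axialAvg (U₁ V) = V) (hbg : ∀ V, X.Uk k V = ukAll X.Uk k (U₁ V))
    (q : GaugeField S.P (k + 1) SU2 → (Free S.P k → E3) → ℝ) (hqm : ∀ V, Measurable (q V))
    (hZ : ∀ V, 0 < partZ (volume : Measure (Free S.P k → E3)) (q V))
    (hU : Measurable (X.UkH k (Hist.triv S.P k))) (hPm : Measurable ((inputOfAC 𝔎 X 𝔖).Pint k (Hist.triv S.P k)))
    (cP : ℝ) (hPb : ∀ U, (inputOfAC 𝔎 X 𝔖).Pint k (Hist.triv S.P k) U ≤ cP)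
    (hinv : GaugeInvariant (fun U : GaugeField S.P k SU2 =>
      Real.exp (-((towerOfAC 𝔎 X 𝔖).mainT k (Hist.triv S.P k) U) + (towerOfAC 𝔎 X 𝔖).Pint k (Hist.triv S.P k) U)))
    (hwt : ∀ U : GaugeField S.P k SU2,
      chiB 𝔎.carrier.M₁ (rcolOf S 𝔎.carrier) (eps1Of S 𝔎.carrier) k (Hist.triv S.P (k + 1)) U ≠ 0 → wtP 𝔎 X win k (Hist.triv S.P k) U = 1)
    (hsmall : ∀ U : GaugeField S.P k SU2,
      chiB 𝔎.carrier.M₁ (rcolOf S 𝔎.carrier) (eps1Of S 𝔎.carrier) k (Hist.triv S.P (k + 1)) U ≠ 0 → axialAvg U ∈ win k (Hist.triv S.P (k + 1)))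
    (hσ : (piecesAC 𝔎 X 𝔖 k).logσ₀ = Real.log sigma0) (hdg : (piecesAC 𝔎 X 𝔖 k).dg = 3)
    (hZU : ∀ V, (piecesAC 𝔎 X 𝔖 k).logZU (Hist.triv S.P (k + 1)) V = Real.log (partZ (volume : Measure (Free S.P k → E3)) (q V)))
    (hFl : ∀ V, (piecesAC 𝔎 X 𝔖 k).logFl (Hist.triv S.P (k + 1)) V =
      Real.log (∫ A, (Set.univ.pi fun _ : Free S.P k => ball (0 : E3) Real.pi).indicator (fun _ => (1 : ℝ)) (S.gk k • A) *
              chiB 𝔎.carrier.M₁ (rcolOf S 𝔎.carrier) (eps1Of S 𝔎.carrier) k (Hist.triv S.P (k + 1)) (fieldAt U₁ (S.gk k) V A) *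
              (∏ i, expWeight ((S.gk k • A) i) / sigma0) *
              Real.exp (-((towerOfAC 𝔎 X 𝔖).mainT k (Hist.triv S.P k) (fieldAt U₁ (S.gk k) V A)
                  - (towerOfAC 𝔎 X 𝔖).mainT (k + 1) (Hist.triv S.P (k + 1)) V)
                + ((towerOfAC 𝔎 X 𝔖).Pint k (Hist.triv S.P k) (fieldAt U₁ (S.gk k) V A) - (piecesAC 𝔎 X 𝔖 k).Pold (Hist.triv S.P (k + 1)) V)
                + q V A)
            ∂(normalized (volume : Measure (Free S.P k → E3)) (q V)))) :
    Fibre55WinAC 𝔎 X 𝔖 win k (Hist.triv S.P (k + 1)) := by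
  classical
  have hint : (fun U => stepWeight 𝔎.carrier.M₁ (rcolOf S 𝔎.carrier) (eps1Of S 𝔎.carrier) (epsSOf S 𝔎.carrier) k (Hist.triv S.P (k + 1)) U *
        chiB 𝔎.carrier.M₁ (rcolOf S 𝔎.carrier) (eps1Of S 𝔎.carrier) k (Hist.triv S.P (k + 1)) U *
        (wtP 𝔎 X win k (Hist.triv S.P (k + 1)).proj U *
          Real.exp (-((towerOfAC 𝔎 X 𝔖).mainT k (Hist.triv S.P (k + 1)).proj U) + (towerOfAC 𝔎 X 𝔖).Pint k (Hist.triv S.P (k + 1)).proj U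
            - (towerOfAC 𝔎 X 𝔖).Ecst k + (towerOfAC 𝔎 X 𝔖).Zterm k (Hist.triv S.P (k + 1)).proj + (towerOfAC 𝔎 X 𝔖).Rm k)))
      = fun U => chiB 𝔎.carrier.M₁ (rcolOf S 𝔎.carrier) (eps1Of S 𝔎.carrier) k (Hist.triv S.P (k + 1)) U *
          Real.exp (-((towerOfAC 𝔎 X 𝔖).mainT k (Hist.triv S.P k) U) + (towerOfAC 𝔎 X 𝔖).Pint k (Hist.triv S.P k) U
            - (towerOfAC 𝔎 X 𝔖).Ecst k + (towerOfAC 𝔎 X 𝔖).Zterm k (Hist.triv S.P k) + (towerOfAC 𝔎 X 𝔖).Rm k) := by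
    funext U
    rw [stepWeight_triv 𝔎.carrier.M₁ (rcolOf S 𝔎.carrier) (eps1Of S 𝔎.carrier) (epsSOf S 𝔎.carrier) (by omega) U, one_mul, Hist.proj_triv]
    by_cases h0 : chiB 𝔎.carrier.M₁ (rcolOf S 𝔎.carrier) (eps1Of S 𝔎.carrier) k (Hist.triv S.P (k + 1)) U = 0
    · rw [h0, zero_mul, zero_mul]
    · rw [hwt U h0, one_mul]
  have hT := transport_triv_ae_eq_fluct 𝔎 X 𝔖 k hk hav U₁ hax hfib hU hPm cP hPb hinv
  have hg : 0 < S.gk k := gk_pos S k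
  have hgk : (towerOfAC 𝔎 X 𝔖).g k = S.gk k := rfl
  have hstar := starB_piecesAC_triv 𝔎 X 𝔖 k hk
  have hproj : (piecesAC 𝔎 X 𝔖 k).proj (Hist.triv S.P (k + 1)) = Hist.triv S.P k := (piecesAC 𝔎 X 𝔖 k).proj_triv
  unfold Fibre55WinAC
  rw [hint]
  refine hT.trans_le ?_
  filter_upwards with V
  by_cases hV : V ∈ win k (Hist.triv S.P (k + 1))
  · -- on the window: both sides are `e^{…}·σ₀^N g_k^{3N} Z(V)` times `∫Ψ` resp. `e^{log ∫Ψ}`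
    rw [Set.indicator_of_mem hV, one_mul, massP_triv 𝔎 X (k + 1) V, one_mul, hσ, hdg, hgk, hstar, hZU V, hproj, hFl V,
      fluct_integral_triv_eq 𝔎 X 𝔖 k hk U₁ hbg q hU hPm cP hPb V (hqm V) (hZ V)]
    refine (exp_mul_le_exp_log_pins _ _ _ _ _ _ sigma0_pos hg (hZ V) (integral_nonneg fun A => ?_)).trans_eq ?_
    · exact mul_nonneg (mul_nonneg (mul_nonneg (Set.indicator_nonneg (fun _ _ => zero_le_one) _) (chiB_nonneg _ _ _ k _ _))
        (Finset.prod_nonneg fun i _ => div_nonneg (T4HaarSU2ExpChart.expWeight_nonneg _) sigma0_pos.le)) (Real.exp_pos _).le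
    · congr 1
      ring
  · -- off the window: the fluctuation integrand vanishes identically (`hsmall`, `axialAvg_fluct_mul`)
    rw [Set.indicator_of_notMem hV, zero_mul, zero_mul]
    have hzero : (fun W : GaugeField S.P k SU2 =>
        chiB 𝔎.carrier.M₁ (rcolOf S 𝔎.carrier) (eps1Of S 𝔎.carrier) k (Hist.triv S.P (k + 1)) (fun b => fluct W b * U₁ V b) *
          Real.exp (-((towerOfAC 𝔎 X 𝔖).mainT k (Hist.triv S.P k) (fun b => fluct W b * U₁ V b))
            + (towerOfAC 𝔎 X 𝔖).Pint k (Hist.triv S.P k) (fun b => fluct W b * U₁ V b)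
            - (towerOfAC 𝔎 X 𝔖).Ecst k + (towerOfAC 𝔎 X 𝔖).Zterm k (Hist.triv S.P k) + (towerOfAC 𝔎 X 𝔖).Rm k))
        = fun _ => 0 := by
      funext W
      have hχ : chiB 𝔎.carrier.M₁ (rcolOf S 𝔎.carrier) (eps1Of S 𝔎.carrier) k (Hist.triv S.P (k + 1)) (fun b => fluct W b * U₁ V b) = 0 := by
        by_contra h
        have hm := hsmall _ h
        rw [axialAvg_fluct_mul k hk U₁ hax hfib V W] at hm
        exact hV hm
      rw [hχ, zero_mul]
    rw [hzero, integral_zero]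

end SU2

end Summit.QuantumFields.YangMills.Theorems.PinnedStepTrivPins

end
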